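import Literature.NumberTheory.LFunctions.RayClassLSeriesZeroSymmetry
import Literature.NumberTheory.LFunctions.RayClassLSeriesLogDerivLocal
import Literature.NumberTheory.LFunctions.ClassGroupLFunctionWindows
import HarnessLib

/-!
# Zeros of Hecke `L`-series of primitive ray class characters in unit windows, and good heights,
# uniformly in the field and the modulus

Topic `Literature/NumberTheory/LFunctions`; namespace `Literature.NumberTheory.LFunctions`.  Pure-proof
companion of `RayClassLSeriesZeroSymmetry.lean`, `RayClassLSeriesLogDerivLocal.lean`; the ray-class analogue
(conductor `𝔣 = 𝔪`) of `ClassGroupLFunctionWindows.lean` (Montgomery–Vaughan Thm. 10.17 / Lemma 12.7 over a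
number field).  Everything here is PROVED; no definition and no named fact is introduced.

For a primitive ray class character `χ mod 𝔪 ≠ 0` of sign type `p`, non-principal on the ideals prime to `𝔪`,
the entire continuations `L`, `L̄` of `L(χ, ·)`, `L(χ̄, ·)`, and the logarithmic scale
`M(τ) = log(|d_K| 𝔑𝔪) + 3 n_K + n_K log(|τ| + 7)`:

* `sum_window_continuation_le` — for a finite set `P` of zeros of `L` with `0 < β < 1`, `|γ − τ| ≤ 1/2`:
  `Σ_{ρ ∈ P} m(ρ) ≤ 64 · M(τ)` (the zeros with `β ≥ 1/2` lie in the Jensen disc `|s − (2 + iτ)| ≤ 31/16` of `L`,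
  the others are reflected by `ρ ↦ 1 − ρ` into that of `L̄` at height `−τ`);
* (private) `finite_zeros_continuation`, `finite_zeroBox_continuation` — the zeros in a compact set / box are finite;
* `exists_goodHeight_continuation` — every `[τ₀, τ₀ + 1]`, `τ₀ ≥ 0`, contains `T` with
  `||γ| − T| ≥ (1/514)/M(T)` for every zero `ρ = β + iγ` of `L` with `0 < β < 1`.

## References

* H. L. Montgomery, R. C. Vaughan, *Multiplicative Number Theory I*, CUP 2007, Thm. 10.17, Lemma 12.7.
  [MontgomeryVaughan2007]
* J. C. Lagarias, A. M. Odlyzko, in *Algebraic Number Fields* (1977), Lemma 5.4. [LagariasOdlyzko1977]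
-/

noncomputable section

open Complex NumberField NumberField.InfinitePlace NumberField.Units IsDedekindDomain Filter Topology Set Metric
  Finset
open scoped NumberField nonZeroDivisors Real
open scoped Classical

namespace Literature.NumberTheory.LFunctions

open Literature.NumberTheory.LFunctions.LogFreeLocal

variable {K : Type*} [Field K] [NumberField K]
variable {𝔪 : Ideal (𝓞 K)} {ψ : HeightOneSpectrum (𝓞 K) → ℂ} {p : Finset {w : InfinitePlace K // IsReal w}}

/-! ### Bookkeeping -/

omit [NumberField K] in
/-- The character `χ̄` is also non-principal on the ideals prime to `𝔪`. [folklore] -/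
private theorem star_nontrivial (hnt : ∃ v : HeightOneSpectrum (𝓞 K), ¬ 𝔪 ≤ v.asIdeal ∧ ψ v ≠ 1) :
    ∃ v : HeightOneSpectrum (𝓞 K), ¬ 𝔪 ≤ v.asIdeal ∧ star ψ v ≠ 1 := by
  obtain ⟨v, hv, hv1⟩ := hnt
  refine ⟨v, hv, fun h ↦ hv1 ?_⟩
  have := congrArg star h
  simpa using this

/-- `L(2 + iτ) ≠ 0` for the continuation. [folklore] -/
private theorem continuation_two_add_ne_zero (h𝔪 : 𝔪 ≠ ⊥) (hψ : IsRayClassCharacter 𝔪 ψ) {L : ℂ → ℂ}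
    (hLs : ∀ s : ℂ, 1 < s.re → L s = rayClassLSeries 𝔪 ψ s) (τ : ℝ) : L (2 + (τ : ℂ) * I) ≠ 0 := by
  have hre : (2 + (τ : ℂ) * I : ℂ).re = 2 := by simp
  have h2 : 1 < (2 + (τ : ℂ) * I : ℂ).re := by rw [hre]; norm_num
  have h := exp_neg_finrank_div_le_norm_rayClassLSeries h𝔪 (fun v hv ↦ (hψ.norm_eq_one v hv).le) h2
  intro h0
  rw [← hLs _ h2, h0, norm_zero] at h
  exact absurd h (not_le.mpr (Real.exp_pos _))

/-- `m_L(ρ) = m_{L̄}(1 − ρ)` for a non-trivial zero (`0 < β < 1`). [folklore] -/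
private theorem zeroOrder_continuation_reflect (hψ : IsRayClassCharacter 𝔪 ψ) (hprim : IsPrimitive 𝔪 ψ)
    (hp : IsSignType 𝔪 ψ p) (h𝔪 : 𝔪 ≠ ⊥) {L L' : ℂ → ℂ} (hL : Differentiable ℂ L)
    (hLs : ∀ s : ℂ, 1 < s.re → L s = rayClassLSeries 𝔪 ψ s) (hL' : Differentiable ℂ L')
    (hL's : ∀ s : ℂ, 1 < s.re → L' s = rayClassLSeries 𝔪 (star ψ) s) {ρ : ℂ} (h1 : 0 < ρ.re) (h2 : ρ.re < 1) :
    zeroOrder L ρ = zeroOrder L' (1 - ρ) := by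
  have hs : ∀ n : ℤ, ρ ≠ n := NumberField.ne_int_of_mem_strip h1 h2
  have h := analyticOrderAt_continuation_eq hψ hprim hp h𝔪 hL hLs hL' hL's hs
  rw [zeroOrder, zeroOrder, analyticOrderNatAt, analyticOrderNatAt, h]

/-! ### Windows -/

/-- **Zeros in a unit window, uniformly in the field and the modulus**: for every finite set `P` of zeros
of the continuation `L` of `L(χ, ·)` with `0 < β < 1`, `|γ − τ| ≤ 1/2`:
`Σ_{ρ ∈ P} m(ρ) ≤ 64 · (log(|d_K|𝔑𝔪) + 3n_K + n_K log(|τ|+7))`. [cite: MontgomeryVaughan2007, Theorem 10.17] -/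
theorem sum_window_continuation_le (hψ : IsRayClassCharacter 𝔪 ψ) (hprim : IsPrimitive 𝔪 ψ)
    (hp : IsSignType 𝔪 ψ p) (h𝔪 : 𝔪 ≠ ⊥)
    (hnt : ∃ v : HeightOneSpectrum (𝓞 K), ¬ 𝔪 ≤ v.asIdeal ∧ ψ v ≠ 1)
    {L L' : ℂ → ℂ} (hL : Differentiable ℂ L) (hLs : ∀ s : ℂ, 1 < s.re → L s = rayClassLSeries 𝔪 ψ s)
    (hL' : Differentiable ℂ L') (hL's : ∀ s : ℂ, 1 < s.re → L' s = rayClassLSeries 𝔪 (star ψ) s)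
    (τ : ℝ) (P : Finset ℂ)
    (hP : ∀ ρ ∈ P, L ρ = 0 ∧ 0 < ρ.re ∧ ρ.re < 1 ∧ |ρ.im - τ| ≤ 1 / 2) :
    ∑ ρ ∈ P, (zeroOrder L ρ : ℝ) ≤
      64 * (Real.log (|(discr K : ℝ)| * (Ideal.absNorm 𝔪 : ℝ)) + 3 * Module.finrank ℚ K +
        Module.finrank ℚ K * Real.log (|τ| + 7)) := by
  set ℳ : ℝ := Real.log (|(discr K : ℝ)| * (Ideal.absNorm 𝔪 : ℝ)) + 3 * Module.finrank ℚ K +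
    Module.finrank ℚ K * Real.log (|τ| + 7) with hℳ
  have hfc : L (2 + (τ : ℂ) * I) ≠ 0 := continuation_two_add_ne_zero h𝔪 hψ hLs τ
  have hgc : L' (2 + ((-τ : ℝ) : ℂ) * I) ≠ 0 := continuation_two_add_ne_zero h𝔪 hψ.star hL's (-τ)
  -- the two Jensen counts (`≤ 32 ℳ` each; `|−τ| = |τ|`)
  have hJ1 : ∑ u ∈ discZeros L τ, (discDivisor L τ u : ℝ) ≤ 32 * ℳ :=
    sum_divisor_continuation_bigDisc_le hψ hprim hp h𝔪 hnt hL hLs τ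
  have hJ2 : ∑ u ∈ discZeros L' (-τ), (discDivisor L' (-τ) u : ℝ) ≤ 32 * ℳ := by
    have h := sum_divisor_continuation_bigDisc_le hψ.star hprim.star hp.star h𝔪 (star_nontrivial hnt) hL' hL's (-τ)
    rw [abs_neg] at h
    exact h
  rw [← sum_filter_add_sum_filter_not P (fun ρ : ℂ ↦ (1 / 2 : ℝ) ≤ ρ.re),
    show (64 : ℝ) * ℳ = 32 * ℳ + 32 * ℳ by ring]
  refine add_le_add ?_ ?_
  · -- right half
    have hsub : P.filter (fun ρ : ℂ ↦ (1 / 2 : ℝ) ≤ ρ.re) ⊆ discZeros L τ := by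
      intro ρ hρ
      rw [mem_filter] at hρ
      obtain ⟨h0, -, h2, h3⟩ := hP ρ hρ.1
      exact (mem_discZeros hL hfc).2 ⟨NumberField.mem_closedBall_of_window hρ.2 (by linarith) h3, h0⟩
    calc ∑ ρ ∈ P.filter (fun ρ : ℂ ↦ (1 / 2 : ℝ) ≤ ρ.re), (zeroOrder L ρ : ℝ)
        = ∑ ρ ∈ P.filter (fun ρ : ℂ ↦ (1 / 2 : ℝ) ≤ ρ.re), (discDivisor L τ ρ : ℝ) := by
          refine sum_congr rfl fun ρ hρ ↦ ?_
          rw [discDivisor_eq_zeroOrder hL hfc ((mem_discZeros hL hfc).1 (hsub hρ)).1]; norm_cast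
      _ ≤ ∑ ρ ∈ discZeros L τ, (discDivisor L τ ρ : ℝ) :=
          sum_le_sum_of_subset_of_nonneg hsub fun ρ _ _ ↦ by exact_mod_cast discDivisor_nonneg hL _ ρ
      _ ≤ 32 * ℳ := hJ1
  · -- left half: reflect
    set P' := P.filter (fun ρ : ℂ ↦ ¬ (1 / 2 : ℝ) ≤ ρ.re) with hP'
    have hinj : Set.InjOn (fun ρ : ℂ ↦ 1 - ρ) ↑P' := fun a _ b _ h ↦ sub_right_injective h
    have heq : ∑ ρ ∈ P', (zeroOrder L ρ : ℝ) = ∑ u ∈ P'.image (fun ρ : ℂ ↦ 1 - ρ), (zeroOrder L' u : ℝ) := by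
      rw [sum_image hinj]
      refine sum_congr rfl fun ρ hρ ↦ ?_
      obtain ⟨-, h1, h2, -⟩ := hP ρ (mem_filter.1 hρ).1
      rw [zeroOrder_continuation_reflect hψ hprim hp h𝔪 hL hLs hL' hL's h1 h2]
    have hsub : P'.image (fun ρ : ℂ ↦ 1 - ρ) ⊆ discZeros L' (-τ) := by
      intro u hu
      obtain ⟨ρ, hρ, rfl⟩ := mem_image.1 hu
      obtain ⟨h0, h1, h2, h3⟩ := hP ρ (mem_filter.1 hρ).1
      have hlt : ρ.re < 1 / 2 := not_le.1 (mem_filter.1 hρ).2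
      refine (mem_discZeros hL' hgc).2 ⟨?_, ?_⟩
      · refine NumberField.mem_closedBall_of_window (τ := -τ) ?_ ?_ ?_
        · simp only [sub_re, one_re]; linarith
        · simp only [sub_re, one_re]; linarith
        · simp only [sub_im, one_im, zero_sub]
          rw [show -ρ.im - -τ = -(ρ.im - τ) by ring, abs_neg]; exact h3
      · have hs : ∀ n : ℤ, ρ ≠ n := NumberField.ne_int_of_mem_strip h1 h2
        exact (continuation_eq_zero_iff hψ hprim hp h𝔪 hL hLs hL' hL's hs).1 h0
    rw [heq]
    calc ∑ u ∈ P'.image (fun ρ : ℂ ↦ 1 - ρ), (zeroOrder L' u : ℝ)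
        = ∑ u ∈ P'.image (fun ρ : ℂ ↦ 1 - ρ), (discDivisor L' (-τ) u : ℝ) := by
          refine sum_congr rfl fun u hu ↦ ?_
          rw [discDivisor_eq_zeroOrder hL' hgc ((mem_discZeros hL' hgc).1 (hsub hu)).1]; norm_cast
      _ ≤ ∑ u ∈ discZeros L' (-τ), (discDivisor L' (-τ) u : ℝ) :=
          sum_le_sum_of_subset_of_nonneg hsub fun u _ _ ↦ by exact_mod_cast discDivisor_nonneg hL' _ u
      _ ≤ 32 * ℳ := hJ2

/-! ### Finiteness of the zeros in compact sets -/

/-- The zeros of the continuation `L` in a compact set are finite. [folklore] -/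
private theorem finite_zeros_continuation (h𝔪 : 𝔪 ≠ ⊥) (hψ : IsRayClassCharacter 𝔪 ψ) {L : ℂ → ℂ}
    (hL : Differentiable ℂ L) (hLs : ∀ s : ℂ, 1 < s.re → L s = rayClassLSeries 𝔪 ψ s) {S : Set ℂ}
    (hS : IsCompact S) : (S ∩ L ⁻¹' {0}).Finite := by
  have han : AnalyticOnNhd ℂ L univ := hL.differentiableOn.analyticOnNhd isOpen_univ
  have h2 : L (2 + ((0 : ℝ) : ℂ) * I) ≠ 0 := continuation_two_add_ne_zero h𝔪 hψ hLs 0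
  have hcod := han.preimage_zero_mem_codiscreteWithin (x := 2 + ((0 : ℝ) : ℂ) * I) h2 (mem_univ _) isConnected_univ
  have hclosed : IsClosed (L ⁻¹' {0}) := by simpa using (mem_codiscrete'.mp hcod).1
  have hdisc : IsDiscrete (L ⁻¹' {0}) := by simpa using (mem_codiscrete'.mp hcod).2
  exact (hS.inter_right hclosed).finite (hdisc.mono inter_subset_right)

/-- The non-trivial zeros of `L` with `|γ| ≤ Y` form a finite set. [folklore] -/
private theorem finite_zeroBox_continuation (h𝔪 : 𝔪 ≠ ⊥) (hψ : IsRayClassCharacter 𝔪 ψ) {L : ℂ → ℂ}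
    (hL : Differentiable ℂ L) (hLs : ∀ s : ℂ, 1 < s.re → L s = rayClassLSeries 𝔪 ψ s) (Y : ℝ) :
    {ρ : ℂ | L ρ = 0 ∧ 0 < ρ.re ∧ ρ.re < 1 ∧ |ρ.im| ≤ Y}.Finite := by
  refine (finite_zeros_continuation h𝔪 hψ hL hLs ((isCompact_Icc (a := (0:ℝ)) (b := 1)).reProdIm
    (isCompact_Icc (a := -Y) (b := Y)))).subset ?_
  rintro ρ ⟨h0, h1, h2, h3⟩
  exact ⟨Complex.mem_reProdIm.2 ⟨⟨h1.le, h2.le⟩, abs_le.1 h3⟩, h0⟩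

/-! ### Good heights -/

omit [NumberField K] in
/-- `ℳ(τ₀ + 1/2) ≤ 2 · ℳ(T)` for `T ∈ [τ₀, τ₀ + 1]`, `τ₀ ≥ 0`. [folklore] -/
private theorem rayDiscBound_le_two_mul {A : ℝ} (hA : 1 ≤ A) (n : ℕ) {τ₀ T : ℝ} (hτ₀ : 0 ≤ τ₀) (hT : τ₀ ≤ T) :
    Real.log A + 3 * n + n * Real.log (|τ₀ + 1 / 2| + 7) ≤ 2 * (Real.log A + 3 * n + n * Real.log (|T| + 7)) := by
  have hlog : Real.log (|τ₀ + 1 / 2| + 7) ≤ 2 * Real.log (|T| + 7) := by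
    rw [abs_of_nonneg (by linarith), abs_of_nonneg (by linarith)]
    calc Real.log (τ₀ + 1 / 2 + 7) ≤ Real.log ((T + 7) ^ 2) := by
          refine Real.log_le_log (by linarith) ?_; nlinarith
      _ = 2 * Real.log (T + 7) := by rw [Real.log_pow]; norm_num
  have hd : 0 ≤ Real.log A := Real.log_nonneg hA
  have hn : (0 : ℝ) ≤ n := Nat.cast_nonneg _
  have hl0 : 0 ≤ Real.log (|T| + 7) := Real.log_nonneg (by linarith [abs_nonneg T])
  nlinarith

/-- **Good heights for the Hecke `L`-series of a primitive ray class character, uniformly in the field and the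
modulus**: with the absolute `c₀ = 1/514`, every interval `[τ₀, τ₀ + 1]`, `τ₀ ≥ 0`, contains a height `T`
such that `||γ| − T| ≥ c₀/ℳ(T)` for every zero `ρ = β + iγ` of `L` with `0 < β < 1`,
`ℳ(T) = log(|d_K|𝔑𝔪) + 3n_K + n_K log(|T|+7)`. [cite: MontgomeryVaughan2007, Lemma 12.7] -/
theorem exists_goodHeight_continuation (hψ : IsRayClassCharacter 𝔪 ψ) (hprim : IsPrimitive 𝔪 ψ)
    (hp : IsSignType 𝔪 ψ p) (h𝔪 : 𝔪 ≠ ⊥)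
    (hnt : ∃ v : HeightOneSpectrum (𝓞 K), ¬ 𝔪 ≤ v.asIdeal ∧ ψ v ≠ 1)
    {L L' : ℂ → ℂ} (hL : Differentiable ℂ L) (hLs : ∀ s : ℂ, 1 < s.re → L s = rayClassLSeries 𝔪 ψ s)
    (hL' : Differentiable ℂ L') (hL's : ∀ s : ℂ, 1 < s.re → L' s = rayClassLSeries 𝔪 (star ψ) s)
    {τ₀ : ℝ} (hτ₀ : 0 ≤ τ₀) :
    ∃ T ∈ Set.Icc τ₀ (τ₀ + 1), ∀ ρ : ℂ, L ρ = 0 → 0 < ρ.re → ρ.re < 1 →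
      (1 / 514) / (Real.log (|(discr K : ℝ)| * (Ideal.absNorm 𝔪 : ℝ)) + 3 * Module.finrank ℚ K +
        Module.finrank ℚ K * Real.log (|T| + 7)) ≤ |(|ρ.im|) - T| := by
  set A : ℝ := |(discr K : ℝ)| * (Ideal.absNorm 𝔪 : ℝ) with hA
  set n : ℕ := Module.finrank ℚ K with hn
  have hA1 : 1 ≤ A := by
    have h1 : (1 : ℝ) ≤ |(discr K : ℝ)| := by
      have := Int.one_le_abs (discr_ne_zero K)
      rw [← Int.cast_abs]; exact_mod_cast this
    have h2 : (1 : ℝ) ≤ (Ideal.absNorm 𝔪 : ℝ) := by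
      exact_mod_cast Nat.one_le_iff_ne_zero.mpr (by rwa [ne_eq, Ideal.absNorm_eq_zero_iff])
    rw [hA]; nlinarith
  -- the zeros of the two windows and their number `M`
  set Wset : Set ℂ := {ρ | L ρ = 0 ∧ 0 < ρ.re ∧ ρ.re < 1 ∧ |(|ρ.im|) - (τ₀ + 1 / 2)| ≤ 1 / 2} with hWset
  have hWfin : Wset.Finite := by
    refine (finite_zeroBox_continuation h𝔪 hψ hL hLs (τ₀ + 1)).subset ?_
    rintro ρ ⟨h0, h1, h2, h3⟩
    refine ⟨h0, h1, h2, ?_⟩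
    rw [abs_le] at h3
    linarith
  set W := hWfin.toFinset with hW
  set M : ℕ := W.card with hM
  have hM1 : (0 : ℝ) < M + 1 := by positivity
  -- pigeonhole
  let φ : ℂ → ℕ := fun ρ ↦ ⌊(|ρ.im| - τ₀) * (M + 1)⌋₊
  have hcard : (W.image φ).card < (Finset.range (M + 1)).card := by
    rw [Finset.card_range]
    exact Nat.lt_succ_of_le (Finset.card_image_le.trans le_rfl)
  obtain ⟨k, hk, hkφ⟩ := Finset.exists_mem_notMem_of_card_lt_card hcard
  rw [Finset.mem_range] at hk
  set T : ℝ := τ₀ + ((k : ℝ) + 1 / 2) / (M + 1) with hT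
  have hk1 : (k : ℝ) + 1 ≤ M + 1 := by exact_mod_cast hk
  have hTlo : τ₀ + (1 / 2) / (M + 1) ≤ T := by
    rw [hT]; gcongr; linarith [(k.cast_nonneg : (0 : ℝ) ≤ k)]
  have hThi : T ≤ τ₀ + 1 - (1 / 2) / (M + 1) := by
    rw [hT, add_sub_assoc, add_le_add_iff_left, le_sub_iff_add_le, ← add_div, div_le_one hM1]
    linarith
  have hδ0 : (0 : ℝ) < (1 / 2) / (M + 1) := by positivity
  have hT0 : 0 ≤ T := by linarith
  refine ⟨T, ⟨by linarith, by linarith⟩, fun ρ h0 h1 h2 ↦ ?_⟩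
  -- Step 1: distance `≥ 1/(2(M+1))`
  have hfar : (1 / 2) / ((M : ℝ) + 1) ≤ |(|ρ.im|) - T| := by
    by_cases hwin : |(|ρ.im|) - (τ₀ + 1 / 2)| ≤ 1 / 2
    · have hρW : ρ ∈ W := by
        rw [hW, Set.Finite.mem_toFinset]
        exact ⟨h0, h1, h2, hwin⟩
      have hne : φ ρ ≠ k := fun h ↦ hkφ (Finset.mem_image.2 ⟨ρ, hρW, h⟩)
      set y : ℝ := (|ρ.im| - τ₀) * (M + 1) with hy
      have hy0 : 0 ≤ y := by
        rw [abs_le] at hwin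
        have : 0 ≤ |ρ.im| - τ₀ := by linarith
        positivity
      have hcase : y < k ∨ (k : ℝ) + 1 ≤ y := by
        by_contra hcon
        rw [not_or, not_lt, not_le] at hcon
        exact hne ((Nat.floor_eq_iff hy0).2 ⟨hcon.1, hcon.2⟩)
      have hyT : |ρ.im| - T = (y - (k + 1 / 2)) / (M + 1) := by
        rw [hT, hy]; field_simp; ring
      rw [hyT, abs_div, abs_of_pos hM1, div_le_div_iff_of_pos_right hM1]
      rcases hcase with h | h
      · rw [abs_of_neg (by linarith)]; linarith
      · rw [abs_of_nonneg (by linarith)]; linarith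
    · rw [not_le] at hwin
      have h1' : |T - (τ₀ + 1 / 2)| ≤ 1 / 2 - (1 / 2) / (M + 1) := by
        rw [abs_le]; constructor <;> linarith
      have h2' := abs_sub_abs_le_abs_sub (|ρ.im| - (τ₀ + 1 / 2)) (T - (τ₀ + 1 / 2))
      rw [show |ρ.im| - (τ₀ + 1 / 2) - (T - (τ₀ + 1 / 2)) = |ρ.im| - T by ring] at h2'
      linarith
  -- Step 2: `M ≤ 2 · 64 · ℳ(τ₀ + 1/2) ≤ 256 · ℳ(T)`
  refine le_trans ?_ hfar
  set ℒ : ℝ := Real.log A + 3 * n + n * Real.log (|T| + 7) with hℒ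
  have hℒ1 : 1 ≤ ℒ := by
    have hd : 0 ≤ Real.log A := Real.log_nonneg hA1
    have hl0 : 0 ≤ Real.log (|T| + 7) := Real.log_nonneg (by linarith [abs_nonneg T])
    have hn1 : (1 : ℝ) ≤ n := by exact_mod_cast Module.finrank_pos
    rw [hℒ]; nlinarith
  have hc2 : L (2 + ((0 : ℝ) : ℂ) * I) ≠ 0 := continuation_two_add_ne_zero h𝔪 hψ hLs 0
  have hMle : (M : ℝ) ≤ 2 * (64 * (Real.log A + 3 * n + n * Real.log (|τ₀ + 1 / 2| + 7))) := by
    have hsum : (M : ℝ) = ∑ ρ ∈ W, (1 : ℝ) := by simp [hM]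
    rw [hsum, ← Finset.sum_filter_add_sum_filter_not W (fun ρ : ℂ ↦ 0 ≤ ρ.im), two_mul]
    refine add_le_add ?_ ?_
    · refine le_trans (Finset.sum_le_sum fun ρ hρ ↦ ?_)
        (sum_window_continuation_le hψ hprim hp h𝔪 hnt hL hLs hL' hL's (τ₀ + 1 / 2) _ fun ρ hρ ↦ ?_)
      · rw [Finset.mem_filter, hW, Set.Finite.mem_toFinset] at hρ
        exact_mod_cast (zeroOrder_pos_iff hL hc2 ρ).2 hρ.1.1
      · rw [Finset.mem_filter, hW, Set.Finite.mem_toFinset] at hρ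
        obtain ⟨⟨h0, h1, h2, h3⟩, him⟩ := hρ
        rw [abs_of_nonneg him] at h3
        exact ⟨h0, h1, h2, h3⟩
    · have h := sum_window_continuation_le hψ hprim hp h𝔪 hnt hL hLs hL' hL's (-(τ₀ + 1 / 2))
        (W.filter (fun ρ : ℂ ↦ ¬ 0 ≤ ρ.im)) fun ρ hρ ↦ by
        rw [Finset.mem_filter, hW, Set.Finite.mem_toFinset, not_le] at hρ
        obtain ⟨⟨h0, h1, h2, h3⟩, him⟩ := hρ
        rw [abs_of_neg him] at h3
        refine ⟨h0, h1, h2, ?_⟩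
        rwa [sub_neg_eq_add, show ρ.im + (τ₀ + 1 / 2) = -(-ρ.im - (τ₀ + 1 / 2)) by ring, abs_neg]
      rw [abs_neg] at h
      refine le_trans (Finset.sum_le_sum fun ρ hρ ↦ ?_) h
      rw [Finset.mem_filter, hW, Set.Finite.mem_toFinset] at hρ
      exact_mod_cast (zeroOrder_pos_iff hL hc2 ρ).2 hρ.1.1
  have hD2 := rayDiscBound_le_two_mul hA1 n hτ₀ (show τ₀ ≤ T by linarith)
  have hM' : (M : ℝ) + 1 ≤ 257 * ℒ := by rw [hℒ]; linarith
  have hℒ0 : 0 < ℒ := by linarith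
  rw [div_le_div_iff₀ hℒ0 hM1]
  nlinarith

end Literature.NumberTheory.LFunctions
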